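import Literature.NumberTheory.EllipticCurves.KubertTwoTwelveProofs
import Literature.NumberTheory.Automorphic.CaraianiNewtonModularityProofs
import HarnessLib

/-!
# Crux `MazurKenkuBound` (stmt-ABC-15125), line `radius-lite` — Kenku's level `15`:
# the eight rational points of `15a1 = X₀(15)` from the finiteness of its Mordell–Weil group

Registered stub `stub_fifteenPoints` of the lead's skeleton: IF the group of rational points of
`E₁ : y² + xy + y = x³ + x² − 10x − 10` (Cremona `15a1`, `[a₁, a₂, a₃, a₄, a₆] = [1, 1, 1, -10, -10]`,
`Δ = 50625 = 3⁴·5⁴`, a model of `X₀(15)`) is finite, THEN every affine rational point of `E₁` is one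
of `(−13/4, 9/8), (−2, −2), (−2, 3), (−1, 0), (3, −2), (8, −27), (8, 18)` (so that
`E₁(ℚ) = {O} ∪ {these seven} ≅ ℤ/4 × ℤ/2`, Cremona's Table 1, `N = 15`, `A1`: `|T| = 8`). The
finiteness (rank `0`) is the sibling stub `stub_fifteenFinite`; here it is only a hypothesis.

## The proof (template: `Literature.NumberTheory.EllipticCurves.KubertTwoTwelveProofs`, curve `24A1`)

1. `E₁` has good reduction at `7` and `11` (`Δ = 50625 = 3⁴5⁴`), with `#Ẽ₁(𝔽₇) = 8` and
   `#Ẽ₁(𝔽₁₁) = 16` (`fifteen_natCard_point_reduction_seven/eleven`, by enumeration of the affine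
   solutions, `decide`).
2. The prime-to-`ℓ` torsion of `E₁(ℚ)` injects into `Ẽ₁(𝔽_ℓ)` (Silverman, *AEC*, Prop. VII.3.1(b);
   the tree's `injective_reduceHom` of `PointReduction.lean` for the `ℓ`-adic absolute value of `ℚ`
   and the residue map `ℤ_(ℓ) → ℤ_ℓ → 𝔽_ℓ`, `fifteen_exists_reduceHom`).
3. **`#E₁(ℚ) ≤ 8`** (`fifteen_natCard_point_le_eight`, under `[Finite E₁(ℚ)]`): a point `P` has an
   order `n = 7ᵃ m`, `7 ∤ m`; `mP` is killed by `7ᵃ`, so lies in the prime-to-`11` torsion, so is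
   killed by `#Ẽ₁(𝔽₁₁) = 16`; hence `16m P = 0` with `7 ∤ 16m`, `P` lies in the prime-to-`7` torsion,
   and all of `E₁(ℚ)` injects into `Ẽ₁(𝔽₇)` of order `8`.
4. `O` and the seven displayed affine points are eight distinct rational points, so they exhaust
   `E₁(ℚ)` (counting coordinate pairs in `Option (ℚ × ℚ)`), which is `stub_fifteenPoints`.

## References

* [CremonaAlgorithms1997] J. E. Cremona, *Algorithms for Modular Elliptic Curves*, 2nd ed., CUP
  1997: Table 1, `N = 15`, curve `A1 = [1, 1, 1, -10, -10]`, `r = 0`, `|T| = 8`; §3.3 (torsion via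
  reduction modulo good primes).
* [SilvermanAEC2009] J. H. Silverman, *The Arithmetic of Elliptic Curves*, 2nd ed., GTM 106:
  Prop. VII.3.1 (torsion injects into the reduction), VII.§2 (reduction modulo `π`).

## Design

Theorems only (no definitions): the curve is written literally as
`(⟨1, 1, 1, -10, -10⟩ : WeierstrassCurve ℚ)`, its reduction as
`(⟨1, 1, 1, -10, -10⟩ : WeierstrassCurve (ZMod ℓ))`, the `ℓ`-adic absolute value of `ℚ` as
`NormedField.valuation.comap (Rat.castHom ℚ_[ℓ])`; the generic local lemmas
`Curve24A1.intCast_mem_integer`, `Curve24A1.valuation_natCast_eq_one` of the template are reused.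
As there, statements involving the group law fix the `DecidableEq` instances to the classical ones
(`letI := Classical.decEq _`), the instances carried by the general theorems of `PointReduction.lean`.
-/

-- `Summit.ABC.ABC` is the mandated summit-side namespace (CONVENTIONS §2); the duplicate is deliberate.
set_option linter.dupNamespace false

noncomputable section

open scoped Classical NNReal
open WeierstrassCurve WeierstrassCurve.Affine
open Literature.NumberTheory.EllipticCurves

namespace Summit.ABC.ABC.Theorems

/-! ### `15a1` over `ℚ`: discriminant, ellipticity, equation -/

-- `Δ(15a1) = 50625 = 3⁴ · 5⁴` is the tree's `Literature.NumberTheory.Automorphic.cremona15a1_Δ`.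

/-- `15a1` is an elliptic curve (`Δ = 50625 ≠ 0`). [cite: CremonaAlgorithms1997, Table 1, N = 15, curve A1] -/
theorem isElliptic_fifteen : (⟨1, 1, 1, -10, -10⟩ : WeierstrassCurve ℚ).IsElliptic :=
  ⟨by rw [Literature.NumberTheory.Automorphic.cremona15a1_Δ]; norm_num⟩

/-- The affine equation of `15a1`: `y² + xy + y = x³ + x² − 10x − 10`.
[cite: CremonaAlgorithms1997, Table 1, N = 15, curve A1] -/
theorem equation_fifteen_iff (x y : ℚ) :
    (⟨1, 1, 1, -10, -10⟩ : WeierstrassCurve ℚ).toAffine.Equation x y ↔ y ^ 2 + x * y + y = x ^ 3 + x ^ 2 - 10 * x - 10 := by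
  rw [Affine.equation_iff]
  constructor <;> intro h <;> linear_combination h

/-! ### `15a1` modulo `ℓ` and its points over `𝔽₇` and `𝔽₁₁` -/

/-- `Δ = 50625` for the reduction `[1, 1, 1, -10, -10]` of `15a1` modulo `ℓ` (the same integral
equation read over `ZMod ℓ`; Silverman, *AEC*, VII.§2, `Ẽ`), so that it is an elliptic curve over
`𝔽_ℓ` for `ℓ ∤ 50625 = 3⁴·5⁴`. [cite: CremonaAlgorithms1997, Table 1, N = 15, curve A1] -/
theorem fifteen_reduction_Δ (ℓ : ℕ) : (⟨1, 1, 1, -10, -10⟩ : WeierstrassCurve (ZMod ℓ)).Δ = 50625 := by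
  norm_num [WeierstrassCurve.Δ, b₂, b₄, b₆, b₈]

/-- The affine equation of `15a1` modulo `ℓ`: `y² + xy + y = x³ + x² − 10x − 10`.
[cite: CremonaAlgorithms1997, Table 1, N = 15, curve A1] -/
theorem equation_fifteen_reduction_iff (ℓ : ℕ) (x y : ZMod ℓ) :
    (⟨1, 1, 1, -10, -10⟩ : WeierstrassCurve (ZMod ℓ)).toAffine.Equation x y ↔
      y ^ 2 + x * y + y = x ^ 3 + x ^ 2 - 10 * x - 10 := by
  rw [Affine.equation_iff]
  constructor <;> intro h <;> linear_combination h

/-- `y² + xy + y = x³ + x² − 10x − 10` has exactly `7` affine solutions over `𝔽₇`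
(`(1, 1), (1, 4), (2, 2), (3, 5), (5, 3), (5, 5), (6, 0)`), by enumeration. [folklore] -/
theorem fifteen_card_solutions_seven :
    Fintype.card {xy : ZMod 7 × ZMod 7 //
      xy.2 ^ 2 + xy.1 * xy.2 + xy.2 = xy.1 ^ 3 + xy.1 ^ 2 - 10 * xy.1 - 10} = 7 := by
  decide

/-- `y² + xy + y = x³ + x² − 10x − 10` has exactly `15` affine solutions over `𝔽₁₁`, by
enumeration. [folklore] -/
theorem fifteen_card_solutions_eleven :
    Fintype.card {xy : ZMod 11 × ZMod 11 //
      xy.2 ^ 2 + xy.1 * xy.2 + xy.2 = xy.1 ^ 3 + xy.1 ^ 2 - 10 * xy.1 - 10} = 15 := by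
  decide

/-- **`#Ẽ₁(𝔽₇) = 8`** for `E₁ = 15a1` (`7` affine points and `O`; equivalently `a₇ = 0`).
[cite: CremonaAlgorithms1997, Table 1, N = 15, curve A1] -/
theorem fifteen_natCard_point_reduction_seven :
    Nat.card (⟨1, 1, 1, -10, -10⟩ : WeierstrassCurve (ZMod 7)).toAffine.Point = 8 := by
  have hΔ : (50625 : ZMod 7) ≠ 0 := by decide
  haveI : Fact (Nat.Prime 7) := ⟨by norm_num⟩
  haveI : (⟨1, 1, 1, -10, -10⟩ : WeierstrassCurve (ZMod 7)).IsElliptic :=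
    ⟨by rw [fifteen_reduction_Δ]; exact isUnit_iff_ne_zero.mpr hΔ⟩
  have e : {xy : ZMod 7 × ZMod 7 //
      (⟨1, 1, 1, -10, -10⟩ : WeierstrassCurve (ZMod 7)).toAffine.Equation xy.1 xy.2} ≃
      {xy : ZMod 7 × ZMod 7 //
        xy.2 ^ 2 + xy.1 * xy.2 + xy.2 = xy.1 ^ 3 + xy.1 ^ 2 - 10 * xy.1 - 10} :=
    Equiv.subtypeEquivRight fun xy => equation_fifteen_reduction_iff 7 xy.1 xy.2
  rw [Nat.card_congr (WeierstrassCurve.Affine.pointEquiv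
    (⟨1, 1, 1, -10, -10⟩ : WeierstrassCurve (ZMod 7)).toAffine)]
  change Nat.card (Option _) = 8
  rw [Finite.card_option, Nat.card_congr e, Nat.card_eq_fintype_card,
    fifteen_card_solutions_seven]

/-- **`#Ẽ₁(𝔽₁₁) = 16`** for `E₁ = 15a1` (`15` affine points and `O`; equivalently `a₁₁ = -4`).
[cite: CremonaAlgorithms1997, Table 1, N = 15, curve A1] -/
theorem fifteen_natCard_point_reduction_eleven :
    Nat.card (⟨1, 1, 1, -10, -10⟩ : WeierstrassCurve (ZMod 11)).toAffine.Point = 16 := by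
  have hΔ : (50625 : ZMod 11) ≠ 0 := by decide
  haveI : Fact (Nat.Prime 11) := ⟨by norm_num⟩
  haveI : (⟨1, 1, 1, -10, -10⟩ : WeierstrassCurve (ZMod 11)).IsElliptic :=
    ⟨by rw [fifteen_reduction_Δ]; exact isUnit_iff_ne_zero.mpr hΔ⟩
  have e : {xy : ZMod 11 × ZMod 11 //
      (⟨1, 1, 1, -10, -10⟩ : WeierstrassCurve (ZMod 11)).toAffine.Equation xy.1 xy.2} ≃
      {xy : ZMod 11 × ZMod 11 //
        xy.2 ^ 2 + xy.1 * xy.2 + xy.2 = xy.1 ^ 3 + xy.1 ^ 2 - 10 * xy.1 - 10} :=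
    Equiv.subtypeEquivRight fun xy => equation_fifteen_reduction_iff 11 xy.1 xy.2
  rw [Nat.card_congr (WeierstrassCurve.Affine.pointEquiv
    (⟨1, 1, 1, -10, -10⟩ : WeierstrassCurve (ZMod 11)).toAffine)]
  change Nat.card (Option _) = 16
  rw [Finite.card_option, Nat.card_congr e, Nat.card_eq_fintype_card,
    fifteen_card_solutions_eleven]

/-! ### Good reduction of `15a1` at `ℓ ∤ 15` and the reduction map on prime-to-`ℓ` torsion -/

section Local

variable (ℓ : ℕ) [Fact ℓ.Prime]

/-- `15a1` is an `ℓ`-integral equation (its coefficients are integers).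
[cite: CremonaAlgorithms1997, Table 1, N = 15, curve A1] -/
theorem isIntegral_fifteen :
    (⟨1, 1, 1, -10, -10⟩ : WeierstrassCurve ℚ).IsIntegral (NormedField.valuation.comap (Rat.castHom ℚ_[ℓ]) : Valuation ℚ ℝ≥0).integer :=
  ⟨⟨⟨1, Curve24A1.intCast_mem_integer ℓ 1⟩, ⟨1, Curve24A1.intCast_mem_integer ℓ 1⟩,
    ⟨1, Curve24A1.intCast_mem_integer ℓ 1⟩, ⟨-10, Curve24A1.intCast_mem_integer ℓ (-10)⟩,
    ⟨-10, Curve24A1.intCast_mem_integer ℓ (-10)⟩⟩, rfl⟩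

/-- **Good reduction**: for `ℓ` prime to `Δ(15a1) = 50625 = 3⁴·5⁴`, `‖Δ‖_ℓ = 1`.
[cite: CremonaAlgorithms1997, Table 1, N = 15, curve A1] -/
theorem fifteen_valuation_Δ (h : IsCoprime (50625 : ℤ) ℓ) :
    (NormedField.valuation.comap (Rat.castHom ℚ_[ℓ]) : Valuation ℚ ℝ≥0) (⟨1, 1, 1, -10, -10⟩ : WeierstrassCurve ℚ).Δ = 1 := by
  rw [Literature.NumberTheory.Automorphic.cremona15a1_Δ, Valuation.comap_apply, ← NNReal.coe_eq_one]
  change ‖((50625 : ℚ) : ℚ_[ℓ])‖ = 1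
  rw [show ((50625 : ℚ) : ℚ_[ℓ]) = ((50625 : ℤ) : ℚ_[ℓ]) by norm_cast]
  exact Padic.norm_intCast_eq_one_iff.mpr h

/-- **The prime-to-`ℓ` torsion of `15a1(ℚ)` injects into `Ẽ₁(𝔽_ℓ)`** at a prime `ℓ` of good
reduction (Silverman, *AEC*, Prop. VII.3.1(b) with Prop. VII.2.1: the reduction map is an
injective homomorphism on the torsion prime to the residue characteristic; here the tree's
`reduceHom` / `injective_reduceHom` of `PointReduction.lean` for the `ℓ`-adic absolute value of
`ℚ`, the residue map `ℤ_(ℓ) → ℤ_ℓ → 𝔽_ℓ` — the inclusion into `ℤ_ℓ` followed by Mathlib's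
`PadicInt.toZMod`, whose kernel is `{‖q‖_ℓ < 1}` (`PadicInt.ker_toZMod`) — and the reduced
equation `[1, 1, 1, -10, -10]` over `𝔽_ℓ`). The group laws are Mathlib's, elaborated against the
classical `DecidableEq` instances (those of `PointReduction.lean`).
[cite: SilvermanAEC2009, Prop. VII.3.1(b)] -/
theorem fifteen_exists_reduceHom (h : IsCoprime (50625 : ℤ) ℓ) :
    letI := Classical.decEq ℚ
    letI := Classical.decEq (ZMod ℓ)
    ∃ f : goodTorsion (NormedField.valuation.comap (Rat.castHom ℚ_[ℓ]) : Valuation ℚ ℝ≥0) (⟨1, 1, 1, -10, -10⟩ : WeierstrassCurve ℚ) →+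
        (⟨1, 1, 1, -10, -10⟩ : WeierstrassCurve (ZMod ℓ)).toAffine.Point,
      Function.Injective f := by
  letI := Classical.decEq ℚ
  letI := Classical.decEq (ZMod ℓ)
  set w : Valuation ℚ ℝ≥0 := NormedField.valuation.comap (Rat.castHom ℚ_[ℓ]) with hw
  have hw1 : ∀ q : ℚ, w q ≤ 1 ↔ ‖(q : ℚ_[ℓ])‖ ≤ 1 := fun q => by
    rw [hw, Valuation.comap_apply, ← NNReal.coe_le_coe, NNReal.coe_one]; rfl
  have hw1' : ∀ q : ℚ, w q < 1 ↔ ‖(q : ℚ_[ℓ])‖ < 1 := fun q => by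
    rw [hw, Valuation.comap_apply, ← NNReal.coe_lt_coe, NNReal.coe_one]; rfl
  haveI : (⟨1, 1, 1, -10, -10⟩ : WeierstrassCurve ℚ).IsIntegral w.integer := isIntegral_fifteen ℓ
  -- the residue map `ℤ_(ℓ) → ℤ_ℓ → 𝔽_ℓ`
  let ι : w.integer →+* ℤ_[ℓ] :=
    { toFun := fun a => ⟨((a : ℚ) : ℚ_[ℓ]), (hw1 a).mp a.2⟩
      map_one' := Subtype.ext (by simp)
      map_mul' := fun a b => Subtype.ext (by simp)
      map_zero' := Subtype.ext (by simp)
      map_add' := fun a b => Subtype.ext (by simp) }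
  let r : w.integer →+* ZMod ℓ := PadicInt.toZMod.comp ι
  have hr : ∀ a : w.integer, r a = 0 ↔ w (a : ℚ) < 1 := fun a => by
    rw [hw1', RingHom.comp_apply, ← RingHom.mem_ker, PadicInt.ker_toZMod,
      IsLocalRing.mem_maximalIdeal, PadicInt.mem_nonunits, PadicInt.norm_def]
    rfl
  have hΔ : w (⟨1, 1, 1, -10, -10⟩ : WeierstrassCurve ℚ).Δ = 1 := fifteen_valuation_Δ ℓ h
  -- the reduced equation
  have hred : reduceCurve r (⟨1, 1, 1, -10, -10⟩ : WeierstrassCurve ℚ) = (⟨1, 1, 1, -10, -10⟩ : WeierstrassCurve (ZMod ℓ)) := by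
    ext
    · show reduceFun r (1 : ℚ) = 1
      exact reduceFun_one r
    · show reduceFun r (1 : ℚ) = 1
      exact reduceFun_one r
    · show reduceFun r (1 : ℚ) = 1
      exact reduceFun_one r
    · show reduceFun r (-10 : ℚ) = -10
      rw [show (-10 : ℚ) = ((-10 : ℤ) : ℚ) by norm_num, reduceFun_intCast]; norm_num
    · show reduceFun r (-10 : ℚ) = -10
      rw [show (-10 : ℚ) = ((-10 : ℤ) : ℚ) by norm_num, reduceFun_intCast]; norm_num
  exact ⟨reduceHom w r hr hΔ hred, injective_reduceHom hr hΔ hred⟩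

end Local

/-! ### `#E₁(ℚ) ≤ 8` by reduction modulo `7` and `11` -/

/-- **`#15a1(ℚ) ≤ 8` once `15a1(ℚ)` is finite** (the bound `|T| ≤ 8` behind Cremona's Table 1
entry `15A1: r = 0, |T| = 8`, obtained as in Cremona §3.3 / Silverman, *AEC*, VII.3.1 by reducing
modulo good primes). Every point `P` has an order `n = 7ᵃ m`, `7 ∤ m`; then `mP` is killed by
`7ᵃ`, lies in the prime-to-`11` torsion, which injects into `Ẽ₁(𝔽₁₁)` of order `16`
(`fifteen_exists_reduceHom`, `fifteen_natCard_point_reduction_eleven`), so `16mP = 0` and `P`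
lies in the prime-to-`7` torsion; the latter injects into `Ẽ₁(𝔽₇)` of order `8`.
[cite: CremonaAlgorithms1997, Table 1, N = 15, curve A1 (|T| = 8)] -/
theorem fifteen_natCard_point_le_eight [Finite (⟨1, 1, 1, -10, -10⟩ : WeierstrassCurve ℚ).toAffine.Point] :
    Nat.card (⟨1, 1, 1, -10, -10⟩ : WeierstrassCurve ℚ).toAffine.Point ≤ 8 := by
  letI := Classical.decEq ℚ
  letI : DecidableEq (ZMod 7) := Classical.decEq _
  letI : DecidableEq (ZMod 11) := Classical.decEq _
  haveI : Fact (Nat.Prime 7) := ⟨by norm_num⟩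
  haveI : Fact (Nat.Prime 11) := ⟨by norm_num⟩
  obtain ⟨f₇, hf₇⟩ := fifteen_exists_reduceHom 7 (by norm_num [Int.isCoprime_iff_gcd_eq_one])
  obtain ⟨f₁₁, hf₁₁⟩ := fifteen_exists_reduceHom 11 (by norm_num [Int.isCoprime_iff_gcd_eq_one])
  haveI : Finite (⟨1, 1, 1, -10, -10⟩ : WeierstrassCurve (ZMod 7)).toAffine.Point :=
    Nat.finite_of_card_ne_zero (by rw [fifteen_natCard_point_reduction_seven]; norm_num)
  -- every rational point lies in the prime-to-`7` torsion
  have hgood : ∀ P : (⟨1, 1, 1, -10, -10⟩ : WeierstrassCurve ℚ).toAffine.Point, P ∈ goodTorsion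
      (NormedField.valuation.comap (Rat.castHom ℚ_[7]) : Valuation ℚ ℝ≥0) (⟨1, 1, 1, -10, -10⟩ : WeierstrassCurve ℚ) := by
    intro P
    obtain ⟨n, hn, hnP⟩ := isOfFinAddOrder_iff_nsmul_eq_zero.mp (isOfFinAddOrder_of_finite P)
    obtain ⟨a, m, hm, rfl⟩ := Nat.exists_eq_pow_mul_and_not_dvd hn.ne' 7 (by norm_num)
    -- `m • P` is killed by `7 ^ a`, hence lies in the prime-to-`11` torsion
    have hR : m • P ∈ goodTorsion
        (NormedField.valuation.comap (Rat.castHom ℚ_[11]) : Valuation ℚ ℝ≥0) (⟨1, 1, 1, -10, -10⟩ : WeierstrassCurve ℚ) := by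
      refine mem_goodTorsion_of_zsmul_eq_zero (n := ((7 ^ a : ℕ) : ℤ)) ?_ ?_
      · rw [Int.cast_natCast]
        exact Curve24A1.valuation_natCast_eq_one 11 (Nat.Coprime.pow_right a (by norm_num))
      · rw [natCast_zsmul, ← mul_nsmul', hnP]
    -- hence is killed by `#Ẽ₁(𝔽₁₁) = 16`
    have h16 : 16 • (m • P) = 0 := by
      have key : (16 : ℕ) • (⟨m • P, hR⟩ : goodTorsion
          (NormedField.valuation.comap (Rat.castHom ℚ_[11]) : Valuation ℚ ℝ≥0) (⟨1, 1, 1, -10, -10⟩ : WeierstrassCurve ℚ)) = 0 := by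
        apply hf₁₁
        rw [map_nsmul, map_zero, ← fifteen_natCard_point_reduction_eleven]
        exact card_nsmul_eq_zero'
      have key' := congrArg Subtype.val key
      simpa using key'
    refine mem_goodTorsion_of_zsmul_eq_zero (n := ((16 * m : ℕ) : ℤ)) ?_ ?_
    · rw [Int.cast_natCast]
      refine Curve24A1.valuation_natCast_eq_one 7 (Nat.Coprime.mul_right (by norm_num) ?_)
      exact (Nat.Prime.coprime_iff_not_dvd (by norm_num)).mpr hm
    · rw [natCast_zsmul, mul_nsmul', h16]
  -- so `E₁(ℚ)` injects into `Ẽ₁(𝔽₇)`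
  have hinj : Function.Injective fun P : (⟨1, 1, 1, -10, -10⟩ : WeierstrassCurve ℚ).toAffine.Point => f₇ ⟨P, hgood P⟩ := by
    intro P Q hPQ
    have := hf₇ hPQ
    simpa using this
  calc Nat.card (⟨1, 1, 1, -10, -10⟩ : WeierstrassCurve ℚ).toAffine.Point
      ≤ Nat.card (⟨1, 1, 1, -10, -10⟩ : WeierstrassCurve (ZMod 7)).toAffine.Point :=
        Nat.card_le_card_of_injective _ hinj
    _ = 8 := fifteen_natCard_point_reduction_seven

/-! ### The registered stub: the rational points of `15a1` -/

/-- **The eight rational points of `15a1` (registered stub `stub_fifteenPoints`).** If `E₁(ℚ)` is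
finite, `E₁ : y² + xy + y = x³ + x² − 10x − 10` (Cremona `15a1 = X₀(15)`), then every affine
rational point of `E₁` is one of `(−13/4, 9/8), (−2, −2), (−2, 3), (−1, 0), (3, −2), (8, −27),
(8, 18)`. Proof: these seven pairs and `O` give eight distinct points of `E₁(ℚ)`, and
`#E₁(ℚ) ≤ 8` (`fifteen_natCard_point_le_eight`: torsion bounded by reduction modulo `7` and `11`,
Silverman *AEC* VII.3.1), so they exhaust `E₁(ℚ)` (counted through the coordinate map
`P ↦ (x(P), y(P))` into `Option (ℚ × ℚ)`).
[cite: CremonaAlgorithms1997, Table 1, N = 15, curve A1 (r = 0, |T| = 8)]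
[cite: SilvermanAEC2009, Prop. VII.3.1] -/
theorem stub_fifteenPoints :
    Finite (⟨1, 1, 1, -10, -10⟩ : WeierstrassCurve ℚ).toAffine.Point →
      ∀ x y : ℚ, y ^ 2 + x * y + y = x ^ 3 + x ^ 2 - 10 * x - 10 →
        (x, y) ∈ ({(-13 / 4, 9 / 8), (-2, -2), (-2, 3), (-1, 0), (3, -2), (8, -27), (8, 18)} :
          Finset (ℚ × ℚ)) := by
  intro hfin x y hxy
  haveI : (⟨1, 1, 1, -10, -10⟩ : WeierstrassCurve ℚ).IsElliptic := isElliptic_fifteen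
  letI : Fintype (⟨1, 1, 1, -10, -10⟩ : WeierstrassCurve ℚ).toAffine.Point := Fintype.ofFinite _
  have hns : ∀ {a b : ℚ}, (⟨1, 1, 1, -10, -10⟩ : WeierstrassCurve ℚ).toAffine.Equation a b → (⟨1, 1, 1, -10, -10⟩ : WeierstrassCurve ℚ).toAffine.Nonsingular a b :=
    fun hab => equation_iff_nonsingular.mp hab
  have hxy' : (⟨1, 1, 1, -10, -10⟩ : WeierstrassCurve ℚ).toAffine.Equation x y := (equation_fifteen_iff x y).mpr hxy
  -- coordinates
  let φ : (⟨1, 1, 1, -10, -10⟩ : WeierstrassCurve ℚ).toAffine.Point → Option (ℚ × ℚ) := fun P => match P with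
    | .zero => none
    | .some a b _ => some (a, b)
  -- the eight known points, by coordinates
  let T : Finset (Option (ℚ × ℚ)) :=
    {none, some (-13 / 4, 9 / 8), some (-2, -2), some (-2, 3), some (-1, 0), some (3, -2),
      some (8, -27), some (8, 18)}
  have hT : T.card = 8 := by
    simp only [T]
    rw [Finset.card_insert_of_notMem, Finset.card_insert_of_notMem, Finset.card_insert_of_notMem,
      Finset.card_insert_of_notMem, Finset.card_insert_of_notMem, Finset.card_insert_of_notMem,
      Finset.card_insert_of_notMem, Finset.card_singleton]
    all_goals
      simp only [Finset.mem_insert, Finset.mem_singleton, reduceCtorEq, Option.some.injEq,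
        Prod.mk.injEq, or_self, not_false_eq_true]
    all_goals norm_num
  have hpt : ∀ {a b : ℚ}, (⟨1, 1, 1, -10, -10⟩ : WeierstrassCurve ℚ).toAffine.Equation a b → some (a, b) ∈ Finset.univ.image φ :=
    fun {a b} hab => Finset.mem_image.mpr ⟨.some a b (hns hab), Finset.mem_univ _, rfl⟩
  have hTsub : T ⊆ Finset.univ.image φ := by
    intro t ht
    simp only [T, Finset.mem_insert, Finset.mem_singleton] at ht
    rcases ht with rfl | rfl | rfl | rfl | rfl | rfl | rfl | rfl
    · exact Finset.mem_image.mpr ⟨0, Finset.mem_univ _, rfl⟩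
    all_goals exact hpt ((equation_fifteen_iff _ _).mpr (by norm_num))
  have hcard : (Finset.univ.image φ).card ≤ T.card := by
    rw [hT]
    calc (Finset.univ.image φ).card ≤ (Finset.univ : Finset (⟨1, 1, 1, -10, -10⟩ : WeierstrassCurve ℚ).toAffine.Point).card :=
          Finset.card_image_le
      _ = Nat.card (⟨1, 1, 1, -10, -10⟩ : WeierstrassCurve ℚ).toAffine.Point := by
          rw [Finset.card_univ, Nat.card_eq_fintype_card]
      _ ≤ 8 := fifteen_natCard_point_le_eight
  have heq : T = Finset.univ.image φ := Finset.eq_of_subset_of_card_le hTsub hcard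
  have hmem : φ (.some x y (hns hxy')) ∈ T := by
    rw [heq]
    exact Finset.mem_image_of_mem φ (Finset.mem_univ (Affine.Point.some x y (hns hxy')))
  simp only [T, φ, Finset.mem_insert, Finset.mem_singleton, Option.some.injEq, reduceCtorEq,
    false_or] at hmem
  simp only [Finset.mem_insert, Finset.mem_singleton]
  exact hmem

end Summit.ABC.ABC.Theorems
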